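import Summits.BirchSwinnertonDyer.BirchSwinnertonDyer.Theorems.TwoAdicConverseGoodOrdinaryPub
import Literature.Uncategorized.OrdPublishedInputsAtTwo
import Literature.NumberTheory.EllipticCurves.SelmerCorankIsogenyProofs
import Literature.NumberTheory.EllipticCurves.IsogenyIdProofs
import Literature.NumberTheory.EllipticCurves.ComplexMultiplicationLFunctionIsogenyHoldsProofs
import HarnessLib

/-!
# Route `TwoAdicConverse` (rung S3), crux `GoodOrdinaryRankZeroTwoConverse`: the Eisenstein child
# WEAKENED FROM THE CONVERSE SIDE — needed only at curves with finite `Sel_{2^∞}` and only UP TO ISOGENY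

Cell `bsd-2adic` (run/shared/lean/pub/bsd-2adic/), seat `bsd-2adic-conv-1` (planner g12 01:42:30Z:
«conv-1 → glue 19168, then the shared crux 19151 from the converse side»). THEOREMS ONLY — nothing
asserted, no definition, no named fact introduced.

The split (gen 1) of the crux `GoodOrdinaryRankZeroTwoConverse` (item stmt-BirchSwinnertonDyer-19218)
asks for the Eisenstein half of the `2`-adic main conjecture `X5.O1.MainConjectureEisensteinDivisibilityAtTwo W`
at EVERY non-CM globally minimal `W` good ordinary at `2` (child 19151, shared with the FORMULA route
ByReductionTypeAtTwo). The CONVERSE consumes strictly less, and this file records how much less,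
kernel-checked against the registered crux decl:

* `goodOrdinaryRankZeroTwoConverse_of_eisensteinHalf_finiteSel_upToIsogeny` — PUBLISHED inputs
  (`Literature.Uncategorized.OrdConversePublishedInputsAtTwo`, item 19167) + the Eisenstein half ONLY
  for curves `W` with `Sel_{2^∞}(E/ℚ)` FINITE, and there only at SOME globally minimal good-ordinary
  curve `W'` ISOGENOUS to `W` (e.g. the distinguished Greenberg Prop-5.14 member of the isogeny class,
  where the X5 instance files certify the main conjecture — cf. the HABITAT SCOPE caveat recorded on
  19150/19151) ⟹ the crux. Mechanism: `corank_{ℤ_2} Sel_{2^∞}` and `ord_{s=1} L(E,s)` are ISOGENY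
  INVARIANTS (tree theorems `IsIsogenous.selmerCorank_eq`, Greenberg LNM 1716 §1, and
  `analyticRank_eq_of_isIsogenous'`, Knapp Thm. 11.67 — both unconditional), so the rank-`0`
  `2`-converse for `W` IS the rank-`0` `2`-converse for `W'`, which is the landed PUB bridge
  `entireLFunction_one_ne_zero_of_finite_selmer_of_facts_of_eisensteinAtTwo` (p409493) at `W'`.
* `analyticRank_eq_zero_of_isIsogenous_of_selmerCorank_two_eq_zero` — the S3-side class invariance
  in isolation: the rank-`0` `2`-converse passes along `ℚ`-isogenies (no reduction hypothesis).

Contrast with the FORMULA side (K4): Miller's `BSD(E,2)` is typed per model and the `2`-adic main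
conjecture with Néron normalisation is certified member by member (μ changes along `2`-isogenies,
Greenberg Prop. 5.13); the converse side needs ONE member per isogeny class and only the `Sel`-finite
ones. HONEST FRAMING: this does not prove 19151 or the crux; on the `Sel`-finite locus the Eisenstein
half at `T = 0` is, via Greenberg 4.1@2 and interpolation, EQUIVALENT to the converse itself (no free
lunch) — the gain is the freedom of the isogenous model and the finite-`Sel` restriction for whoever
attacks 19151 by Eisenstein congruences at `2`. PARTITION (D-0054): none — RANK axis (S3); companion
formula cell X5@2 good-ord (B1·O1; 611 book230 classes), object
`X5.O1.MainConjectureEisensteinDivisibilityAtTwo`, owner bsd-2adic.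

References: [GreenbergLNM1716] §1 (pp. 54–57), Thm. 4.1 (p. 102), Prop. 5.13; [Knapp1993] Thm. 11.67;
[Kato2004Asterisque] Thm. 17.4 (1) (p. 273); [SkinnerUrban2014] Thm. 3.6.11 (shape; p odd).
-/

set_option linter.dupNamespace false
set_option autoImplicit false

noncomputable section

open scoped Classical

open WeierstrassCurve Literature.NumberTheory.EllipticCurves
  Literature.NumberTheory.EllipticCurves.Rank1Residual
  Summit.BirchSwinnertonDyer.Rank1Residual.X5
  Summit.BirchSwinnertonDyer.BirchSwinnertonDyer.Theses.TwoAdicConverse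

namespace Summit.BirchSwinnertonDyer.BirchSwinnertonDyer.Theorems

/-- **The rank-`0` `2`-converse passes along `ℚ`-isogenies.** If `W ∼_ℚ W'` and the converse
`corank_{ℤ_2} Sel_{2^∞}(W'/ℚ) = 0 ⟹ ord_{s=1} L(W', s) = 0` holds for `W'`, it holds for `W`: both
sides are isogeny invariants (`IsIsogenous.selmerCorank_eq`, `analyticRank_eq_of_isIsogenous'`).
[cite: GreenbergLNM1716, §1 pp. 54–57] [cite: Knapp1993, Thm. 11.67] -/
theorem analyticRank_eq_zero_of_isIsogenous_of_selmerCorank_two_eq_zero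
    {W W' : WeierstrassCurve ℚ} [W.IsElliptic] [W'.IsElliptic] (hiso : IsIsogenous W W')
    (hconv' : W'.selmerCorank 2 = 0 → W'.analyticRank = 0) (hsel : W.selmerCorank 2 = 0) :
    W.analyticRank = 0 := by
  rw [analyticRank_eq_of_isIsogenous' hiso]
  exact hconv' (by rw [← hiso.selmerCorank_eq 2]; exact hsel)

/-- **The crux from the Eisenstein half on the finite-`Sel` locus, up to isogeny.** Assume the three
PUBLISHED inputs of the converse (`hP` = `Literature.Uncategorized.OrdConversePublishedInputsAtTwo`:
modularity, Kato 17.4 (1)(2) at `2`, Greenberg Thm. 4.1 parity-free) and (`hE`): for every non-CM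
globally minimal `W` good ordinary at `2` WITH `Sel_{2^∞}(W/ℚ)` FINITE there is a globally minimal
`W'`, `ℚ`-isogenous to `W` and good ordinary at `2`, at which the Eisenstein half
`X5.O1.MainConjectureEisensteinDivisibilityAtTwo W'` holds. Then `GoodOrdinaryRankZeroTwoConverse`.
Proof: corank `0` for `W` ⟹ corank `0` for `W'` (isogeny) ⟹ `Sel_{2^∞}(W')` finite ⟹ `L(W',1) ≠ 0`
(landed bridge `entireLFunction_one_ne_zero_of_finite_selmer_of_facts_of_eisensteinAtTwo`, p409493:
Greenberg 4.1@2 + Eisenstein half + interpolation) ⟹ `r_an(W') = 0 = r_an(W)` (isogeny).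
[cite: GreenbergLNM1716, Thm. 4.1 (p. 102) and §1 (pp. 54–57)] [cite: Knapp1993, Thm. 11.67]
[cite: Kato2004Asterisque, Thm. 17.4 (1) (p. 273)] -/
theorem goodOrdinaryRankZeroTwoConverse_of_eisensteinHalf_finiteSel_upToIsogeny
    (hP : Literature.Uncategorized.OrdConversePublishedInputsAtTwo)
    (hE : ∀ (W : WeierstrassCurve ℚ) [W.IsElliptic] [W.IsGloballyMinimal], ¬ W.HasCM → GoodOrd W 2 →
      Finite (W.selmerGroupPInfty 2) →
        ∃ (W' : WeierstrassCurve ℚ) (_ : W'.IsElliptic) (_ : W'.IsGloballyMinimal),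
          IsIsogenous W W' ∧ GoodOrd W' 2 ∧ O1.MainConjectureEisensteinDivisibilityAtTwo W') :
    GoodOrdinaryRankZeroTwoConverse := by
  unfold GoodOrdinaryRankZeroTwoConverse
  intro W _ _ hcm hgo hsel
  obtain ⟨hmod, h17, hGr⟩ := hP
  have hSel : Finite (W.selmerGroupPInfty 2) :=
    (finite_selmerGroupPInfty_iff_selmerCorank_eq_zero W 2).2 hsel
  obtain ⟨W', _, _, hiso, hgo', hE'⟩ := hE W hcm hgo hSel
  refine analyticRank_eq_zero_of_isIsogenous_of_selmerCorank_two_eq_zero hiso (fun hsel' ↦ ?_) hsel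
  exact analyticRank_eq_zero_of_entireLFunction_one_ne_zero W'
    (entireLFunction_one_ne_zero_of_finite_selmer_of_facts_of_eisensteinAtTwo W' hmod
      (fun f => h17 W' f) hGr hgo' hE'
      ((finite_selmerGroupPInfty_iff_selmerCorank_eq_zero W' 2).2 hsel'))

/-- **Special case: the Eisenstein half on the finite-`Sel` locus (same model).** PUBLISHED inputs
+ the Eisenstein half at every non-CM globally minimal good-ordinary-at-`2` curve WITH FINITE
`Sel_{2^∞}` ⟹ the crux (take `W' = W`). This is child 19151 restricted to the only curves the
converse ever looks at. [cite: GreenbergLNM1716, Thm. 4.1 (p. 102)]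
[cite: Kato2004Asterisque, Thm. 17.4 (1) (p. 273)] -/
theorem goodOrdinaryRankZeroTwoConverse_of_eisensteinHalf_finiteSel
    (hP : Literature.Uncategorized.OrdConversePublishedInputsAtTwo)
    (hE : ∀ (W : WeierstrassCurve ℚ) [W.IsElliptic] [W.IsGloballyMinimal], ¬ W.HasCM → GoodOrd W 2 →
      Finite (W.selmerGroupPInfty 2) → O1.MainConjectureEisensteinDivisibilityAtTwo W) :
    GoodOrdinaryRankZeroTwoConverse :=
  goodOrdinaryRankZeroTwoConverse_of_eisensteinHalf_finiteSel_upToIsogeny hP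
    fun W _ _ hcm hgo hSel ↦
      ⟨W, inferInstance, inferInstance, isIsogenous_self W, hgo, hE W hcm hgo hSel⟩

end Summit.BirchSwinnertonDyer.BirchSwinnertonDyer.Theorems

end
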